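import Literature.Barriers.CriticalPhenomena.SupercriticalSAWSpaceFillingSteps
import Literature.Barriers.CriticalPhenomena.SupercriticalSAWSpaceFillingProofs
import HarnessLib

/-!
# Problem 10 of Duminil-Copin–Kozma–Yadin 2014 (the critical SAW is not space-filling):
# status, non-vacuity of the vendored `Prop`, and its place below the sub-problem

Companion of `Literature/Barriers/CriticalPhenomena/SupercriticalSAWSpaceFilling.lean`, which
vendors, next to Theorem 1 of H. Duminil-Copin, G. Kozma, A. Yadin, *Supercritical self-avoiding
walks are space-filling*, Ann. IHP Probab. Stat. 50 (2014) 315–326 (arXiv:1110.3074), the disk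
instance of the paper's Problem 10 as an OPEN `Prop`,
`SupercriticalSAW.DKY2014_problem10_disk` (for all `a ≠ b` on the unit circle and all
closest-site endpoint families `A δ, B δ`, the critical family `lawAt x_c 𝔻_δ (A δ) (B δ)` is not
space-filling in the weak sense `SupercriticalSAW.IsSpaceFillingFamily` of §1).

## Status of the fact (provefact audit, 2026-08)

* What the source prints (§4 "Questions", arXiv p. 8): "Another challenge is to try to say
  something nontrivial about the critical phase. Recently, the uniformly chosen self-avoiding
  walk on `ℤ^d` was proved to be sub-ballistic [DH12]. A natural question would be to prove that
  it is *not* space-filling. **Problem 10.** When `x = 1/μ` and `(Ω,a,b)` is sufficiently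
  regular, show that the sequence `(γ_δ)` does not become space-filling." It is posed as an open
  problem; the paper proves nothing at `x = 1/μ`.
* No later source resolves it: the works citing the paper up to 2026 that concern the critical
  phase (Duminil-Copin–Hammond 2013, sub-ballisticity; Duminil-Copin–Glazman–Hammond–Manolescu
  2016, endpoint delocalisation; Krachun–Panagiotis, *Quantitative sub-ballisticity of
  self-avoiding walk on the hexagonal lattice*, arXiv:2310.17299, whose introduction states "the
  low-dimensional cases are more challenging, and the gap between what is known and what is
  conjectured to be true is very large") bound how FAST the critical walk travels, not how
  DENSE it is. Hence `DKY2014_problem10_disk` is not discharged here (nor weakened): it stays a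
  `def … : Prop`.
* The `Prop` is stated non-degenerately: its universally quantified hypotheses are realisable
  (`DKY2014_problem10_disk_hypotheses_realizable`: boundary points `1 ≠ -1`, closest-site
  families exist at every mesh since `𝔻_δ` is finite and contains the origin,
  `exists_isClosestSite`), so it is not vacuously true; and SAWs from `A δ` to `B δ` exist at
  every mesh (`reachable_discreteDomainGraph_unitDisk`: any two sites of `𝔻_δ` are joined in
  `𝔻_δ`), so the "no walk" junk case of `lawAt` (`SupercriticalSAW.lawAt_eq_zero_or_isProbabilityMeasure`)
  does not occur for the laws it speaks about (the other junk case, infinite total weight, is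
  excluded by the finiteness of `𝔻_δ`, `meshDomain_finite`; not formalised here).

## What is proved (namespace `Literature.Barriers.CriticalPhenomena.SupercriticalSAW`)

* `exists_isClosestSite`, `exists_closestSiteFamily`,
  `DKY2014_problem10_disk_hypotheses_realizable` (non-vacuity, see above), and
  `DKY2014_problem10_disk.exists_not_isSpaceFillingFamily` (under Problem 10 as a hypothesis, a
  concrete critical family — closest sites to `1, -1` — is not space-filling).
* `reachable_discreteDomainGraph_unitDisk` (any two sites of `𝔻_δ` are joined in `𝔻_δ`),
  `tendsto_meshPoint_of_isClosestSite` (closest sites converge to their boundary point, from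
  `IsClosestSite.dist_le`), and `isEndpointApprox_unitDisc_of_isClosestSite`: the closest-site
  families of the source for `(a, b) = (1, -1)` form an endpoint approximation
  (`Literature.Probability.RandomPlanarGeometry.SAW.IsEndpointApprox`) of the library's Dobrushin
  domain `DobrushinDomain.unitDisc = (𝔻; 1, -1)`.
* `IsSpaceFillingFamily.not_sawScalingLimit`: a critical (`x = x_c`) space-filling family along
  an endpoint approximation of a Dobrushin domain `D` refutes the sub-problem
  `Literature.Probability.RandomPlanarGeometry.SAW.SAWScalingLimit`, given the two inputs of
  `IsSpaceFillingFamily.not_convergesInLawToSLE` (chordal SLE_{8/3} in `D` misses some ball with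
  positive pre-Wiener probability; `isProjectiveLimit_preWienerMeasure`). Consequently
  `DKY2014_problem10_unitDisc_of_sawScalingLimit`: the `(𝔻; 1, -1)` instance of Problem 10
  follows from the Lawler–Schramm–Werner conjecture `SAWScalingLimit` and these inputs — the
  formal counterpart of the source's "When `x = 1/μ`: `γ_δ` should converge to a random simple
  curve" (§1, p. 2). Problem 10 thus sits BELOW the summit conjunct: a space-filling critical
  walk in the disk would refute `SAWScalingLimit`.

Nothing here is a result of the source about the critical walk; the source's own contribution
at `x = x_c` is the problem statement.
-/

noncomputable section

open MeasureTheory Filter Topology Metric Set Literature.Probability.LatticeModels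
  Literature.Probability.Percolation Literature.Probability.RandomPlanarGeometry
  Literature.Probability.RandomPlanarGeometry.SAW
open scoped ENNReal NNReal

namespace Literature.Barriers.CriticalPhenomena.SupercriticalSAW

/-! ### Closest sites exist: the hypotheses of Problem 10 / Theorem 1 are realisable -/

/-- For every mesh `δ > 0` and every point `z`, some site of `𝔻_δ` minimises the distance of its
mesh point to `z` ("`a_δ, b_δ` the two sites of `Ω_δ` closest to `a` and `b`"): `𝔻_δ` is finite
and contains the origin. [cite: DuminilCopinKozmaYadin2014, §1 (a_δ, b_δ)] -/
theorem exists_isClosestSite {δ : ℝ} (hδ : 0 < δ) (z : ℂ) :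
    ∃ v : Site 2, IsClosestSite unitDisk δ z v := by
  have hfin : (meshDomain unitDisk δ).Finite := meshDomain_finite Metric.isBounded_ball hδ
  have hne : (meshDomain unitDisk δ).Nonempty :=
    ⟨0, by rw [meshDomain_unitDisk]; exact zero_mem_meshVertices_unitDisk δ⟩
  obtain ⟨v, hv, hmin⟩ := Set.exists_min_image _ (fun w => dist (meshPoint δ w) z) hfin hne
  exact ⟨v, hv, hmin⟩

/-- A closest-site family `δ ↦ z_δ` exists for every point `z` (a choice of minimiser at each
`δ > 0`; junk value `0` at `δ ≤ 0`). [cite: DuminilCopinKozmaYadin2014, §1 (a_δ, b_δ)] -/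
theorem exists_closestSiteFamily (z : ℂ) :
    ∃ A : ℝ → Site 2, ∀ δ : ℝ, 0 < δ → IsClosestSite unitDisk δ z (A δ) := by
  classical
  refine ⟨fun δ => if h : 0 < δ then (exists_isClosestSite h z).choose else 0, fun δ hδ => ?_⟩
  simp only [dif_pos hδ]
  exact (exists_isClosestSite hδ z).choose_spec

/-- **Non-vacuity of the vendored Problem 10 (and of the hypotheses of Theorem 1).** There are
boundary points `a ≠ b` of the unit disk (`1` and `-1`) with closest-site endpoint families at
every mesh, so the universally quantified hypotheses of `DKY2014_problem10_disk` and
`DKY2014_thm1` are realisable and neither `Prop` is vacuously true. [folklore] -/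
theorem DKY2014_problem10_disk_hypotheses_realizable :
    ∃ (a b : ℂ) (A B : ℝ → Site 2), ‖a‖ = 1 ∧ ‖b‖ = 1 ∧ a ≠ b ∧
      ∀ δ : ℝ, 0 < δ → IsClosestSite unitDisk δ a (A δ) ∧ IsClosestSite unitDisk δ b (B δ) := by
  obtain ⟨A, hA⟩ := exists_closestSiteFamily (1 : ℂ)
  obtain ⟨B, hB⟩ := exists_closestSiteFamily (-1 : ℂ)
  refine ⟨1, -1, A, B, by simp, by simp, ?_, fun δ hδ => ⟨hA δ hδ, hB δ hδ⟩⟩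
  intro h
  have h2 := congrArg Complex.re h
  norm_num at h2

/-- Under Problem 10 (as a hypothesis) a concrete critical family in the disk — closest sites to
`1` and `-1` — is not space-filling: the `Prop` has non-vacuous content.
[cite: DuminilCopinKozmaYadin2014, §4 Problem 10] -/
theorem DKY2014_problem10_disk.exists_not_isSpaceFillingFamily (h : DKY2014_problem10_disk) :
    ∃ A B : ℝ → Site 2,
      (∀ δ : ℝ, 0 < δ → IsClosestSite unitDisk δ 1 (A δ) ∧ IsClosestSite unitDisk δ (-1) (B δ)) ∧
        ¬ IsSpaceFillingFamily criticalFugacity unitDisk A B := by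
  obtain ⟨A, hA⟩ := exists_closestSiteFamily (1 : ℂ)
  obtain ⟨B, hB⟩ := exists_closestSiteFamily (-1 : ℂ)
  have hne : (1 : ℂ) ≠ -1 := by
    intro h1
    have h2 := congrArg Complex.re h1
    norm_num at h2
  exact ⟨A, B, fun δ hδ => ⟨hA δ hδ, hB δ hδ⟩,
    h 1 (-1) (by simp) (by simp) hne A B fun δ hδ => ⟨hA δ hδ, hB δ hδ⟩⟩

/-! ### Closest-site families are endpoint approximations of `(𝔻; 1, -1)` -/

/-- Any two sites of `𝔻_δ` are joined by a walk of the graph `𝔻_δ` (the mesh vertex graph of the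
disk is preconnected, `meshVertexGraph_unitDisk_preconnected`, and maps into `𝔻_δ`). In
particular SAWs from `a_δ` to `b_δ` exist (a reachable pair is joined by a path), so the
"no walk" junk case of `lawAt x 𝔻_δ a_δ b_δ` does not occur. [folklore] -/
theorem reachable_discreteDomainGraph_unitDisk {δ : ℝ} {u v : Site 2}
    (hu : u ∈ meshDomain unitDisk δ) (hv : v ∈ meshDomain unitDisk δ) :
    (discreteDomainGraph unitDisk δ).Reachable u v := by
  rw [meshDomain_unitDisk] at hu hv
  let hom : meshVertexGraph unitDisk δ →g discreteDomainGraph unitDisk δ :=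
    { toFun := Subtype.val
      map_rel' := fun {p q} h => discreteDomainGraph_adj_iff.2
        ⟨h, by rw [meshDomain_unitDisk]; exact p.2, by rw [meshDomain_unitDisk]; exact q.2⟩ }
  exact (meshVertexGraph_unitDisk_preconnected δ ⟨u, hu⟩ ⟨v, hv⟩).map hom

/-- The mesh points of a closest-site family converge to their boundary point as `δ → 0⁺`
(they are within `3δ` of it, `IsClosestSite.dist_le`). [cite: DuminilCopinKozmaYadin2014, §1 (a_δ, b_δ)] -/
theorem tendsto_meshPoint_of_isClosestSite {z : ℂ} (hz : ‖z‖ = 1) {A : ℝ → Site 2}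
    (hA : ∀ δ : ℝ, 0 < δ → IsClosestSite unitDisk δ z (A δ)) :
    Tendsto (fun δ => meshPoint δ (A δ)) (𝓝[>] (0 : ℝ)) (𝓝 z) := by
  rw [Metric.tendsto_nhds]
  intro ε hε
  filter_upwards [Ioo_mem_nhdsGT (lt_min (by positivity : (0 : ℝ) < ε / 3)
    (by norm_num : (0 : ℝ) < 1 / 4))] with δ hδ
  have hδε : δ < ε / 3 := hδ.2.trans_le (min_le_left _ _)
  have hδ4 : δ ≤ 1 / 4 := (hδ.2.trans_le (min_le_right _ _)).le
  calc dist (meshPoint δ (A δ)) z ≤ 3 * δ := (hA δ hδ.1).dist_le hδ.1 hδ4 hz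
    _ < ε := by linarith

/-- **The closest sites of the source are an endpoint approximation.** For `(a, b) = (1, -1)`,
closest-site families `A δ, B δ` of the disk satisfy the library's hypothesis structure
`IsEndpointApprox (𝔻; 1, -1) A B` of the sub-problem: they lie in `𝔻_δ` and are joined there at
every mesh, and their mesh points tend to `1` and `-1`. [cite: DuminilCopinKozmaYadin2014, §1 (a_δ, b_δ)] -/
theorem isEndpointApprox_unitDisc_of_isClosestSite {A B : ℝ → Site 2}
    (h : ∀ δ : ℝ, 0 < δ → IsClosestSite unitDisk δ 1 (A δ) ∧ IsClosestSite unitDisk δ (-1) (B δ)) :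
    IsEndpointApprox DobrushinDomain.unitDisc A B := by
  -- the marked points of `(𝔻; 1, -1)` (cf. `Literature.Probability.Percolation.unitDisc_pt_zero`)
  have hpt0 : DobrushinDomain.unitDisc.pt 0 = 1 := by
    show circleMap 0 1 (2 * Real.pi * ((![0, 1 / 2] : Fin 2 → ℝ) 0)) = 1
    simp [circleMap]
  have hpt1 : DobrushinDomain.unitDisc.pt 1 = -1 := by
    show circleMap 0 1 (2 * Real.pi * ((![0, 1 / 2] : Fin 2 → ℝ) 1)) = -1
    have h2 : (2 * Real.pi * ((![0, 1 / 2] : Fin 2 → ℝ) 1) : ℝ) = Real.pi := by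
      simp only [Matrix.cons_val_one, Matrix.cons_val_fin_one]
      ring
    rw [h2]
    simp [circleMap, Complex.exp_pi_mul_I]
  refine ⟨?_, ?_, ?_⟩
  · filter_upwards [self_mem_nhdsWithin] with δ hδ
    exact reachable_discreteDomainGraph_unitDisk (h δ hδ).1.1 (h δ hδ).2.1
  · rw [hpt0]
    exact tendsto_meshPoint_of_isClosestSite (by simp) fun δ hδ => (h δ hδ).1
  · rw [hpt1]
    exact tendsto_meshPoint_of_isClosestSite (by simp) fun δ hδ => (h δ hδ).2

/-! ### Problem 10 sits below the sub-problem `SAWScalingLimit` -/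

section BelowSubproblem

variable {D : DobrushinDomain} {A B : ℝ → Site 2}

/-- **A space-filling CRITICAL family refutes the sub-problem.** If along an endpoint
approximation `(A, B)` of a Dobrushin domain `D` the critical laws `lawAt x_c Ω_δ (A δ) (B δ)`
(`= Literature.Probability.RandomPlanarGeometry.SAW.law`, `lawAt_criticalFugacity`) are
space-filling in the weak sense of §1, and chordal SLE_{8/3} in `D` misses some ball with
positive pre-Wiener probability (input, as in `IsSpaceFillingFamily.not_convergesInLawToSLE`),
then `SAWScalingLimit` fails (`sawScalingLimitAt_criticalFugacity`). This is the sense in which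
a negative answer to Problem 10 would bear on the summit. [cite: DuminilCopinKozmaYadin2014, §1 (When x = 1/μ) and §4 Problem 10] -/
theorem IsSpaceFillingFamily.not_sawScalingLimit (hAB : IsEndpointApprox D A B)
    (hfill : IsSpaceFillingFamily criticalFugacity D.carrier A B)
    (hmiss : ∀ Γ : (ℝ≥0 → ℝ) → CurveClass ℂ, IsSLECurve ((8 : ℝ≥0) / 3) D Γ →
      ∃ z : ℂ, ∃ r : ℝ, 0 < r ∧ ball z r ⊆ D.carrier ∧
        Literature.Probability.Process.preWienerMeasure
          {ω | Disjoint (ball z (2 * r)) (Γ ω).range} ≠ 0)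
    (hW : Literature.Probability.Process.isProjectiveLimit_preWienerMeasure) :
    ¬ SAWScalingLimit :=
  fun h => not_sawScalingLimitAt_of_isSpaceFillingFamily hAB hfill hmiss hW
    (sawScalingLimitAt_criticalFugacity.mpr h)

/-- **The `(𝔻; 1, -1)` instance of Problem 10 from the Lawler–Schramm–Werner conjecture.** If
`SAWScalingLimit` holds and chordal SLE_{8/3} in `(𝔻; 1, -1)` misses some ball with positive
pre-Wiener probability (with `isProjectiveLimit_preWienerMeasure`), then for all closest-site
families `A δ → 1`, `B δ → -1` the critical SAW in the disk is not space-filling — the source's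
"When `x = 1/μ`: `γ_δ` should converge to a random simple curve" made formal for this instance.
Problem 10 itself (unconditionally) remains open. [cite: DuminilCopinKozmaYadin2014, §1 (When x = 1/μ) and §4 Problem 10] -/
theorem DKY2014_problem10_unitDisc_of_sawScalingLimit (hSAW : SAWScalingLimit)
    (hmiss : ∀ Γ : (ℝ≥0 → ℝ) → CurveClass ℂ, IsSLECurve ((8 : ℝ≥0) / 3) DobrushinDomain.unitDisc Γ →
      ∃ z : ℂ, ∃ r : ℝ, 0 < r ∧ ball z r ⊆ unitDisk ∧
        Literature.Probability.Process.preWienerMeasure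
          {ω | Disjoint (ball z (2 * r)) (Γ ω).range} ≠ 0)
    (hW : Literature.Probability.Process.isProjectiveLimit_preWienerMeasure)
    {A B : ℝ → Site 2}
    (h : ∀ δ : ℝ, 0 < δ → IsClosestSite unitDisk δ 1 (A δ) ∧ IsClosestSite unitDisk δ (-1) (B δ)) :
    ¬ IsSpaceFillingFamily criticalFugacity unitDisk A B :=
  fun hfill => hfill.not_sawScalingLimit (D := DobrushinDomain.unitDisc)
    (isEndpointApprox_unitDisc_of_isClosestSite h) hmiss hW hSAW

end BelowSubproblem

end Literature.Barriers.CriticalPhenomena.SupercriticalSAW
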